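import Literature.AlgebraicGeometry.Frobenioids.KummerCupProductFN
import Literature.AlgebraicGeometry.Frobenioids.KummerH1Discrete
import HarnessLib

/-!
# Frobenioids II, Def. 2.2 (ii): the duality isomorphism `H¹(H_A, μ_N(A)) ⥲ H_A^ab ⊗ F_N(A)` FROM THE
# CUP PRODUCT (construction modulo the two bijectivity inputs)

Mochizuki, *The geometry of Frobenioids II*, Kyushu J. Math. **62** (2008), §2, Def. 2.2 (ii) p. 18: "by
the well-known duality theory of nonarchimedean [mixed-characteristic] local fields [NSW 7.2.6], the
cup product on group cohomology … determines an isomorphism `H¹(H, μ_N(A)) ⥲ H^ab ⊗ H²(H, μ_N(A))` …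
we obtain a natural isomorphism `H¹(H_A, μ_N(A)) ⥲ H_A^ab ⊗ F_N(A)`" [cite: MochizukiFrdII2008, Def 2.2 p.18].
abc-iut-L1-t7 carries this isomorphism as a DATUM (`Kummer.DualityIso`). Cell abc-iut, cross-layer row
**L1-γ₁**, milestone M3 (seat abc-iut-L2-t12): its CONSTRUCTION as the cup-product map, modulo exactly
the two bijectivity statements that are local Tate duality / local class field theory:

* `homToH1Triv` — `Hom(H_A^ab, ℤ/N) → H¹(H_A, ℤ/Nℤ)` (trivial coefficients: a homomorphism IS a crossed
  homomorphism); `cupDual N O H_A q : H¹(H_A, μ_N(A)) →+ (Hom(H_A^ab, ℤ/N) →+ F_N(A))`,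
  `x ↦ (χ ↦ x ∪ χ)` — the cup product of `KummerCupProductFN.lean` in adjoint form;
* `FN.nsmul_eq_zero` — `F_N(A)` is killed by `N`; `thetaHom N O H_A q : H_A^ab ⊗ F_N(A) →+
  (Hom(H_A^ab, ℤ/N) →+ F_N(A))`, `a ⊗ φ ↦ (χ ↦ χ(a) · φ)` (`thetaHom_tmul`) — the tautological map
  which is bijective when `H_A` is finite and `F_N(A) ≅ ℤ/Nℤ`;
* **`dualityIsoOfCupProduct N O H_A q hθ hcup : Kummer.DualityIso N O H_A q`** — for `hθ : Bijective
  thetaHom` and `hcup : Bijective cupDual`: the isomorphism `θ⁻¹ ∘ cupDual ∘ h1MuEquiv` on t7's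
  domain `H1 (Rep.ofMulDistribMulAction H_A μ_N(A))` (`KummerH1Discrete.h1MuEquiv`), characterised by
  `thetaHom_dualityIsoOfCupProduct : θ (ι c) = cupDual (h1MuEquiv c)`.

The naturality (Thm. 2.4 (i), "(γ₁)" of abc-iut-L1-d4) follows from `Def22Context.Iso.isoFN_cupFN`
(`KummerCupProductFN.lean`) and the naturality of `θ` and `h1MuEquiv` — next file. Discharging `hθ`,
`hcup` at `Def22Context.ofLocalField` (finiteness of `Gal`, `F_N ≅ ℤ/N`, and the trunk's
`localDuality_bijective`) is milestone M4. Classical; nothing here concerns [IUTchIII]; universe `0`.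
-/

noncomputable section

namespace Literature.AlgebraicGeometry.Frobenioids

namespace Kummer

open CategoryTheory groupCohomology Literature.NumberTheory.GaloisRepresentations
open scoped TensorProduct

variable {Γ : Type} [Group Γ] [TopologicalSpace Γ] [DiscreteTopology Γ]
  (N : ℕ) (O : Type) [CommMonoid O] [MulDistribMulAction Γ O] (HA : Subgroup Γ)

/-! ### `Hom(H_A^ab, ℤ/N) → H¹(H_A, ℤ/Nℤ)` -/

omit [TopologicalSpace Γ] [DiscreteTopology Γ] in
/-- The action of `trivTopRep` is trivial. [cite: MochizukiFrdII2008, Def 2.2 (ii) p.17] -/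
@[simp] theorem trivTopRep_ρ_apply (g : HA) (x : ZMod N) : (trivTopRep N HA).ρ g x = x := by
  change Representation.trivial ℤ HA (ZMod N) g x = x
  simp

/-- A homomorphism `χ : H_A^ab → ℤ/N` as a continuous crossed homomorphism of the (discrete) group `H_A`
with TRIVIAL coefficients `ℤ/N`. [cite: MochizukiFrdII2008, Def 2.2 p.18] -/
def homToCocycleTriv (χ : Additive (Abelianization HA) →+ ZMod N) : contOneCocycles (trivTopRep N HA) :=
  ⟨⟨fun h => χ (Additive.ofMul (Abelianization.of h)), continuous_of_discreteTopology⟩, fun g h => by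
    rw [trivTopRep_ρ_apply]
    change χ (Additive.ofMul (Abelianization.of (g * h))) =
      χ (Additive.ofMul (Abelianization.of g)) + χ (Additive.ofMul (Abelianization.of h))
    rw [map_mul, ofMul_mul, map_add]⟩

/-- `homToCocycleTriv χ h = χ([h])`. [cite: MochizukiFrdII2008, Def 2.2 p.18] -/
@[simp] theorem homToCocycleTriv_apply (χ : Additive (Abelianization HA) →+ ZMod N) (h : HA) :
    (homToCocycleTriv N HA χ).1 h = χ (Additive.ofMul (Abelianization.of h)) := rfl

/-- **`Hom(H_A^ab, ℤ/N) → H¹(H_A, ℤ/Nℤ)`**, `χ ↦ [h ↦ χ([h])]` (for trivial coefficients a homomorphism is a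
crossed homomorphism; Serre I §2.3 "`H¹(G, A) = Hom(G, A)`"). [cite: MochizukiFrdII2008, Def 2.2 p.18] -/
def homToH1Triv : (Additive (Abelianization HA) →+ ZMod N) →+ continuousCohomology 1 (trivTopRep N HA) :=
  AddMonoidHom.mk' (fun χ => oneCocycleClass (trivTopRep N HA) (homToCocycleTriv N HA χ)) fun χ χ' => by
    rw [← oneCocycleClass_add]
    exact congrArg _ (Subtype.ext (ContinuousMap.ext fun _ => rfl))

/-- Unfolding `homToH1Triv`. [cite: MochizukiFrdII2008, Def 2.2 p.18] -/
@[simp] theorem homToH1Triv_apply (χ : Additive (Abelianization HA) →+ ZMod N) :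
    homToH1Triv N HA χ = oneCocycleClass (trivTopRep N HA) (homToCocycleTriv N HA χ) := rfl

/-! ### The cup product in adjoint form -/

variable {H : Type} [Group H] [TopologicalSpace H] [IsTopologicalGroup H] (q : H →ₜ* HA)

/-- **`cupDual : H¹(H_A, μ_N(A)) → Hom(Hom(H_A^ab, ℤ/N), F_N(A))`**, `x ↦ (χ ↦ x ∪ χ)`: the cup product
`H¹(H_A, μ_N(A)) × H¹(H_A, ℤ/Nℤ) → F_N(A)` of FrdII p. 18 in adjoint form, `H¹(H_A, ℤ/Nℤ)` being fed by
`Hom(H_A^ab, ℤ/N)`. [cite: MochizukiFrdII2008, Def 2.2 p.18] -/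
def cupDual : continuousCohomology 1 (muTopRep N O HA) →+
    ((Additive (Abelianization HA) →+ ZMod N) →+ FN N O HA q) :=
  AddMonoidHom.mk' (fun x => (cupFN N O HA q x).comp (homToH1Triv N HA)) fun x x' => by
    ext χ
    simp only [AddMonoidHom.coe_comp, Function.comp_apply, map_add, AddMonoidHom.add_apply]

/-- `cupDual x χ = x ∪ [χ]`. [cite: MochizukiFrdII2008, Def 2.2 p.18] -/
@[simp] theorem cupDual_apply (x : continuousCohomology 1 (muTopRep N O HA))
    (χ : Additive (Abelianization HA) →+ ZMod N) :
    cupDual N O HA q x χ = cupFN N O HA q x (homToH1Triv N HA χ) := rfl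

/-! ### `F_N(A)` is killed by `N`; the tautological map `θ : H_A^ab ⊗ F_N(A) → Hom(Hom(H_A^ab, ℤ/N), F_N(A))` -/

/-- `H²(H_A, μ_N(A))` is killed by `N` (the coefficients are). [cite: MochizukiFrdII2008, Def 2.2 (ii) p.17] -/
theorem H2Mu.nsmul_eq_zero (y : continuousCohomology 2 (muTopRep N O HA)) : N • y = 0 := by
  haveI : LocallyCompactSpace HA := locallyCompactSpace_of_discrete HA
  obtain ⟨f, rfl⟩ := twoCocycleClass_surjective (muTopRep N O HA) y
  have hf : N • f = 0 := by
    refine Subtype.ext (ContinuousMap.ext fun p => ?_)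
    change N • (f.1 p : Additive (Mu N O)) = 0
    exact Mu.nsmul_eq_zero N O _
  rw [← twoCocycleClassₗ_apply, ← map_nsmul, hf, map_zero]

/-- **`F_N(A)` is killed by `N`.** [cite: MochizukiFrdII2008, Def 2.2 (ii) p.17] -/
theorem FN.nsmul_eq_zero (φ : FN N O HA q) : N • φ = 0 := by
  induction φ using QuotientAddGroup.induction_on with
  | H y => rw [← QuotientAddGroup.mk_nsmul, H2Mu.nsmul_eq_zero, QuotientAddGroup.mk_zero]

/-- `F_N(A)` as a `ℤ/Nℤ`-module (reducible, used locally). [cite: MochizukiFrdII2008, Def 2.2 (ii) p.17] -/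
abbrev FN.zmodModule : Module (ZMod N) (FN N O HA q) :=
  AddCommGroup.zmodModule (FN.nsmul_eq_zero N O HA q)

/-- `χ ↦ χ(a) · φ` as a homomorphism `Hom(H_A^ab, ℤ/N) → F_N(A)`. [cite: MochizukiFrdII2008, Def 2.2 p.18] -/
def evalSMul (a : Additive (Abelianization HA)) (φ : FN N O HA q) :
    (Additive (Abelianization HA) →+ ZMod N) →+ FN N O HA q :=
  letI : Module (ZMod N) (FN N O HA q) := FN.zmodModule N O HA q
  { toFun := fun χ => χ a • φ
    map_zero' := zero_smul _ φ
    map_add' := fun χ χ' => add_smul (χ a) (χ' a) φ }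

/-- `evalSMul a φ χ = χ(a) · φ`. [cite: MochizukiFrdII2008, Def 2.2 p.18] -/
theorem evalSMul_apply (a : Additive (Abelianization HA)) (φ : FN N O HA q)
    (χ : Additive (Abelianization HA) →+ ZMod N) :
    evalSMul N O HA q a φ χ = (letI : Module (ZMod N) (FN N O HA q) := FN.zmodModule N O HA q; χ a • φ) :=
  rfl

/-- The `ℤ`-bilinear map `(a, φ) ↦ (χ ↦ χ(a) · φ)`. [cite: MochizukiFrdII2008, Def 2.2 p.18] -/
def thetaBilin : Additive (Abelianization HA) →ₗ[ℤ] FN N O HA q →ₗ[ℤ]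
    ((Additive (Abelianization HA) →+ ZMod N) →+ FN N O HA q) :=
  letI : Module (ZMod N) (FN N O HA q) := FN.zmodModule N O HA q
  LinearMap.mk₂ ℤ (evalSMul N O HA q)
    (fun a a' φ => AddMonoidHom.ext fun χ => by
      simp only [evalSMul_apply, AddMonoidHom.add_apply, map_add, add_smul])
    (fun c a φ => AddMonoidHom.ext fun χ => by
      simp only [evalSMul_apply, AddMonoidHom.smul_apply, map_zsmul, zsmul_eq_mul, mul_smul,
        Int.cast_smul_eq_zsmul])
    (fun a φ φ' => AddMonoidHom.ext fun χ => by
      simp only [evalSMul_apply, AddMonoidHom.add_apply, smul_add])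
    (fun c a φ => AddMonoidHom.ext fun χ => by
      simp only [evalSMul_apply, AddMonoidHom.smul_apply]
      exact (ZMod.map_smul (zsmulAddGroupHom c : FN N O HA q →+ FN N O HA q) (χ a) φ).symm)

/-- **`θ : H_A^ab ⊗ F_N(A) → Hom(Hom(H_A^ab, ℤ/N), F_N(A))`, `a ⊗ φ ↦ (χ ↦ χ(a) · φ)`** — the tautological
map through which "`H¹(H_A, μ_N(A)) ⥲ H_A^ab ⊗ F_N(A)` induced by the cup product" (p. 18) is read: the cup
product lands in `Hom(H¹(H_A, ℤ/N), F_N) = Hom(Hom(H_A^ab, ℤ/N), F_N)`, and `θ` is bijective for `H_A` finite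
and `F_N(A) ≅ ℤ/N`. [cite: MochizukiFrdII2008, Def 2.2 p.18] -/
def thetaHom : RecTarget N O HA q →+ ((Additive (Abelianization HA) →+ ZMod N) →+ FN N O HA q) :=
  (TensorProduct.lift (thetaBilin N O HA q)).toAddMonoidHom

/-- `θ(a ⊗ φ)(χ) = χ(a) · φ`. [cite: MochizukiFrdII2008, Def 2.2 p.18] -/
@[simp] theorem thetaHom_tmul (a : Additive (Abelianization HA)) (φ : FN N O HA q)
    (χ : Additive (Abelianization HA) →+ ZMod N) :
    thetaHom N O HA q (a ⊗ₜ φ) χ =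
      (letI : Module (ZMod N) (FN N O HA q) := FN.zmodModule N O HA q; χ a • φ) := by
  change TensorProduct.lift (thetaBilin N O HA q) (a ⊗ₜ φ) χ = _
  rw [TensorProduct.lift.tmul]
  rfl

/-! ### The duality isomorphism from the cup product -/

/-- **The isomorphism `H¹(H_A, μ_N(A)) ⥲ H_A^ab ⊗ F_N(A)` "induced by the cup product"** (FrdII p. 18),
CONSTRUCTED as `θ⁻¹ ∘ cupDual ∘ h1MuEquiv` on abc-iut-L1-t7's domain `H1 (Rep.ofMulDistribMulAction H_A
μ_N(A))`, modulo its two bijectivity inputs: `hθ` (`H_A` finite, `F_N(A) ≅ ℤ/N`) and `hcup` = local Tate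
duality for `H¹(−, μ_N) × H¹(−, ℤ/N) → H²(−, μ_N)` transported along condition (c)
[NSW 7.2.6]. [cite: MochizukiFrdII2008, Def 2.2 p.18] -/
def dualityIsoOfCupProduct (hθ : Function.Bijective (thetaHom N O HA q))
    (hcup : Function.Bijective (cupDual N O HA q)) : DualityIso N O HA q where
  toAddEquiv := (h1MuEquiv N O HA).toAddEquiv.trans
    ((AddEquiv.ofBijective (cupDual N O HA q) hcup).trans (AddEquiv.ofBijective (thetaHom N O HA q) hθ).symm)

/-- **Characterisation**: `θ (ι c) = cupDual (h1MuEquiv c)` — the duality isomorphism IS the cup product,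
read through `θ`. [cite: MochizukiFrdII2008, Def 2.2 p.18] -/
theorem thetaHom_dualityIsoOfCupProduct (hθ : Function.Bijective (thetaHom N O HA q))
    (hcup : Function.Bijective (cupDual N O HA q)) (c : H1 (Rep.ofMulDistribMulAction HA (Mu N O))) :
    thetaHom N O HA q ((dualityIsoOfCupProduct N O HA q hθ hcup).toAddEquiv c) =
      cupDual N O HA q (h1MuEquiv N O HA c) := by
  change thetaHom N O HA q ((AddEquiv.ofBijective (thetaHom N O HA q) hθ).symm
    (AddEquiv.ofBijective (cupDual N O HA q) hcup (h1MuEquiv N O HA c))) = _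
  exact (AddEquiv.ofBijective (thetaHom N O HA q) hθ).apply_symm_apply _

/-- … equivalently, on Kummer-type classes: for a cocycle `κ`, `θ (ι [κ]) χ = [κ] ∪ [χ]` in `F_N(A)`.
[cite: MochizukiFrdII2008, Def 2.2 p.18] -/
theorem thetaHom_dualityIsoOfCupProduct_apply (hθ : Function.Bijective (thetaHom N O HA q))
    (hcup : Function.Bijective (cupDual N O HA q)) (c : H1 (Rep.ofMulDistribMulAction HA (Mu N O)))
    (χ : Additive (Abelianization HA) →+ ZMod N) :
    thetaHom N O HA q ((dualityIsoOfCupProduct N O HA q hθ hcup).toAddEquiv c) χ =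
      cupFN N O HA q (h1MuEquiv N O HA c) (homToH1Triv N HA χ) := by
  rw [thetaHom_dualityIsoOfCupProduct, cupDual_apply]

end Kummer

end Literature.AlgebraicGeometry.Frobenioids
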